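import Mathlib
import HarnessLib
import Literature.Analysis.FluidPDE.LocalPressureLiouville
import Summits.NavierStokesRegularity.NavierStokesRegularity.Theorems.PoloidalWindowDoorPoloidalWindowRigidityPressureGaugeTools
import Summits.NavierStokesRegularity.NavierStokesRegularity.Theorems.PoloidalWindowDoorPoloidalWindowRigidityProfileScaling

/-!
# Route `PoloidalWindowDoor`, crux `PoloidalWindowRigidity` (K2, stmt-NavierStokesRegularity-19708) —
# THE SLICE PRESSURE-GRADIENT FUNCTIONAL DOES NOT DEPEND ON THE REGULARISATION SCALE; the test bump `λ_R(c − ·)`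

Cell ns-regularity-ideate, seat nsreg-p7 (gen 6, third worker under the K2 lead; `--supports stmt-…-19708`).
Brick of the discharge of the K2 lead's hypothesis (F1) (`…LargeScaleEnergy`, `hBMO`).  For a measurable
uniformly locally `L²` field `w`, `q ∈ L¹_loc`, and the slice pressure Poisson equation `∫ q Δθ = −∫ D²θ(w,w)`,
the functional

  `g^δ(c) = ∫ [q(x) ∂ₑλ_δ(c − x) + D³Φ_δ(c − x)(e)(w x, w x)] dx`      (`Φ_δ = newtonReg δ`, `λ_δ = ΔΦ_δ`)

satisfies **`g^δ(c) = g^{δ'}(c)` for all `δ, δ' > 0`** (`sliceFunctional_eq_of_poisson`): `χ = Φ_δ − Φ_{δ'}` is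
smooth and compactly supported (both equal `Γ` off the larger ball), so `θ = ∂ₑχ(c − ·)` is a test function with
`Δθ = ∂ₑ(λ_δ − λ_{δ'})(c − ·)` and `D²θ(a,a) = D³χ(c − ·)(e)(a,a)`, and the Poisson equation is exactly
`g^δ − g^{δ'} = 0`.  Consequently the pg-identities at the small scales `δ = 1/(n+1)` consumed by the tree's
`slice_pressure_oscillation_le` may be proved at a LARGE scale `δ = R`, where `λ_R` is a bump of width `R` and
every kernel is `O(1/R)` in `L¹` (`…ProfileScaling`).  The file also records the test bump
`θ_R = λ_R(c − ·)`: it is a test function and `∫‖Dθ_R‖ = R⁻¹∫‖Dλ₁‖`, `∫‖D²θ_R‖ = R⁻²∫‖D²λ₁‖`,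
`∫‖Δθ_R‖ = R⁻²∫‖Δλ₁‖`, `∫|θ_R| = ∫|λ₁|` (reflection/translation invariance), and the integration by parts
`∫ q ∂ₑλ(c − ·) = ∫ ∂ₑq λ(c − ·)` for `q ∈ C¹` (`pressureTerm_eq_integral_fderiv_mul`).

WHAT THIS IS NOT: not a claim about Navier–Stokes regularity and not the open residue S2⁗ — potential theory
of one slice (bears_on LADDER-NS N0 via crux K2 = stmt-19708; whole-class tool).
-/

noncomputable section

-- the summit and its single sub-problem share the name (CONVENTIONS §1), as in every Theorems file
set_option linter.dupNamespace false
-- nested operator types `ℝ³ →L[ℝ] ℝ³ →L[ℝ] ℝ³ →L[ℝ] ℝ`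
set_option maxSynthPendingDepth 3

namespace Summit.NavierStokesRegularity.NavierStokesRegularity.Theorems.PoloidalWindowDoorPoloidalWindowRigiditySliceFunctionalScale

open MeasureTheory Set Function Filter Topology Metric InnerProductSpace
open scoped RealInnerProductSpace ENNReal NNReal Laplacian ContDiff
open Literature.Analysis Literature.Analysis.FluidPDE
open Summit.NavierStokesRegularity.NavierStokesRegularity.Theorems.PoloidalWindowDoorPoloidalWindowRigidityPressureGaugeTools
open Summit.NavierStokesRegularity.NavierStokesRegularity.Theorems.PoloidalWindowDoorPoloidalWindowRigidityProfileScaling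

/-! ## Calculus of the test function `∂ₑχ(c − ·)` -/

/-- `Δ(∂ₑχ(c − ·))(x) = ∂ₑ(Δχ)(c − x)` for `χ ∈ C³`. [folklore] -/
theorem laplacian_fderiv_comp_const_sub {χ : EuclideanSpace ℝ (Fin 3) → ℝ} (hχ : ContDiff ℝ 3 χ)
    (c e x : EuclideanSpace ℝ (Fin 3)) :
    Δ (fun y => fderiv ℝ χ (c - y) e) x = fderiv ℝ (Δ χ) (c - x) e := by
  rw [laplacian_comp_const_sub (fun z => fderiv ℝ χ z e) c x, ← fderiv_laplacian_apply hχ]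

/-- `D²(∂ₑχ(c − ·))(x)(a,a) = D³χ(c − x)(e)(a)(a)` for `χ ∈ C³`. [folklore] -/
theorem fderiv2_fderiv_comp_const_sub_apply {χ : EuclideanSpace ℝ (Fin 3) → ℝ} (hχ : ContDiff ℝ 3 χ)
    (c e x a : EuclideanSpace ℝ (Fin 3)) :
    fderiv ℝ (fderiv ℝ (fun y => fderiv ℝ χ (c - y) e)) x a a =
      fderiv ℝ (fderiv ℝ (fderiv ℝ χ)) (c - x) e a a := by
  set g : EuclideanSpace ℝ (Fin 3) → ℝ := fun z => fderiv ℝ χ z e with hg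
  have hg2 : ContDiff ℝ 2 g := (hχ.fderiv_right (m := 2) (by norm_num)).clm_apply contDiff_const
  rw [show (fun y => fderiv ℝ χ (c - y) e) = fun y => g (c - y) from rfl, fderiv2_comp_const_sub g c x]
  have hdg : DifferentiableAt ℝ (fderiv ℝ g) (c - x) :=
    ((hg2.fderiv_right (m := 1) (by norm_num)).differentiable (by norm_num)) _
  rw [← FluidPDE.fderiv_apply_const_apply hdg a a, hg, ← fderiv3_comm hχ (c - x) e a,
    ← fderiv3_apply_apply_self hχ (c - x) e a]

/-! ## The difference profile `χ = Φ_δ − Φ_{δ'}` -/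

section Chi

variable {δ δ' : ℝ}

/-- `χ = Φ_δ − Φ_{δ'}` vanishes off the ball of radius `max δ δ'`. [folklore] -/
theorem newtonReg_sub_eq_zero (hδ : 0 < δ) (hδ' : 0 < δ') {z : EuclideanSpace ℝ (Fin 3)}
    (hz : max δ δ' ≤ ‖z‖) : newtonReg δ z - newtonReg δ' z = 0 := by
  rw [newtonReg_eq_newtonKernel hδ ((le_max_left _ _).trans hz),
    newtonReg_eq_newtonKernel hδ' ((le_max_right _ _).trans hz), sub_self]

/-- `χ = Φ_δ − Φ_{δ'}` is smooth and compactly supported. [folklore] -/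
theorem contDiff_and_hasCompactSupport_newtonReg_sub (hδ : 0 < δ) (hδ' : 0 < δ') {n : ℕ∞} :
    ContDiff ℝ n (fun z => newtonReg δ z - newtonReg δ' z) ∧
      HasCompactSupport (fun z => newtonReg δ z - newtonReg δ' z) := by
  refine ⟨(contDiff_newtonReg δ).sub (contDiff_newtonReg δ'), ?_⟩
  refine HasCompactSupport.intro (isCompact_closedBall (0 : EuclideanSpace ℝ (Fin 3)) (max δ δ'))
    fun z hz => ?_
  rw [mem_closedBall_zero_iff, not_le] at hz
  exact newtonReg_sub_eq_zero hδ hδ' hz.le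

/-- `θ = ∂ₑχ(c − ·)` is a test function on `ℝ³`. [folklore] -/
theorem isTestFunctionOn_fderiv_newtonReg_sub (hδ : 0 < δ) (hδ' : 0 < δ') (c e : EuclideanSpace ℝ (Fin 3)) :
    FunctionSpaces.IsTestFunctionOn (⊤ : TopologicalSpace.Opens (EuclideanSpace ℝ (Fin 3)))
      (fun y => fderiv ℝ (fun z => newtonReg δ z - newtonReg δ' z) (c - y) e) := by
  have hs : ∀ n : ℕ, ContDiff ℝ n (fun z => newtonReg δ z - newtonReg δ' z) := fun n =>
    (contDiff_and_hasCompactSupport_newtonReg_sub hδ hδ' (n := n)).1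
  refine ⟨?_, ?_, by simp⟩
  · refine contDiff_infty.2 fun n => ?_
    exact (((hs (n + 1)).fderiv_right (m := n) (by push_cast; exact le_rfl)).clm_apply contDiff_const).comp
      (contDiff_const.sub contDiff_id)
  · refine HasCompactSupport.intro (isCompact_closedBall c (max δ δ')) fun y hy => ?_
    rw [mem_closedBall, dist_eq_norm, not_le, ← norm_sub_rev] at hy
    have hopen : IsOpen {z : EuclideanSpace ℝ (Fin 3) | max δ δ' < ‖z‖} := isOpen_lt continuous_const continuous_norm
    have hev : (fun z => newtonReg δ z - newtonReg δ' z) =ᶠ[𝓝 (c - y)] fun _ => (0 : ℝ) := by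
      filter_upwards [hopen.mem_nhds hy] with z hz
      exact newtonReg_sub_eq_zero hδ hδ' (le_of_lt hz)
    rw [hev.fderiv_eq, fderiv_const_apply, _root_.zero_apply]

/-- `∂ₑ(Δχ)(z) = ∂ₑλ_δ(z) − ∂ₑλ_{δ'}(z)`. [folklore] -/
theorem fderiv_laplacian_newtonReg_sub (hδ : 0 < δ) (hδ' : 0 < δ') (z e : EuclideanSpace ℝ (Fin 3)) :
    fderiv ℝ (Δ (fun z => newtonReg δ z - newtonReg δ' z)) z e =
      fderiv ℝ (Δ (newtonReg δ)) z e - fderiv ℝ (Δ (newtonReg δ')) z e := by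
  have hΔ : Δ (fun z => newtonReg δ z - newtonReg δ' z) = fun z => Δ (newtonReg δ) z - Δ (newtonReg δ') z := by
    funext w
    exact ((contDiff_newtonReg δ (n := 2)).contDiffAt.laplacian_sub (contDiff_newtonReg δ' (n := 2)).contDiffAt)
  rw [hΔ, fderiv_fun_sub (((contDiff_laplacian_newtonReg hδ (n := 1)).differentiable one_ne_zero) z)
    (((contDiff_laplacian_newtonReg hδ' (n := 1)).differentiable one_ne_zero) z), _root_.sub_apply]

/-- `D³χ(z) = D³Φ_δ(z) − D³Φ_{δ'}(z)`. [folklore] -/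
theorem fderiv3_newtonReg_sub (δ δ' : ℝ) (z : EuclideanSpace ℝ (Fin 3)) :
    fderiv ℝ (fderiv ℝ (fderiv ℝ (fun z => newtonReg δ z - newtonReg δ' z))) z =
      fderiv ℝ (fderiv ℝ (fderiv ℝ (newtonReg δ))) z - fderiv ℝ (fderiv ℝ (fderiv ℝ (newtonReg δ'))) z := by
  have h1 : fderiv ℝ (fun z => newtonReg δ z - newtonReg δ' z) =
      fun z => fderiv ℝ (newtonReg δ) z - fderiv ℝ (newtonReg δ') z := by
    funext w
    exact fderiv_fun_sub (((contDiff_newtonReg δ (n := 1)).differentiable one_ne_zero) w)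
      (((contDiff_newtonReg δ' (n := 1)).differentiable one_ne_zero) w)
  have hd1 : ∀ ε : ℝ, Differentiable ℝ (fderiv ℝ (newtonReg ε)) := fun ε =>
    ((contDiff_newtonReg ε (n := 2)).fderiv_right (m := 1) (by norm_num)).differentiable one_ne_zero
  have hd2 : ∀ ε : ℝ, Differentiable ℝ (fderiv ℝ (fderiv ℝ (newtonReg ε))) := fun ε =>
    (((contDiff_newtonReg ε (n := 3)).fderiv_right (m := 2) (by norm_num)).fderiv_right (m := 1)
      (by norm_num)).differentiable one_ne_zero
  have h2 : fderiv ℝ (fderiv ℝ (fun z => newtonReg δ z - newtonReg δ' z)) =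
      fun z => fderiv ℝ (fderiv ℝ (newtonReg δ)) z - fderiv ℝ (fderiv ℝ (newtonReg δ')) z := by
    rw [h1]; funext w; exact fderiv_fun_sub ((hd1 δ) w) ((hd1 δ') w)
  rw [h2]
  exact fderiv_fun_sub ((hd2 δ) z) ((hd2 δ') z)

end Chi

/-! ## `δ`-independence of the slice functional -/

section Independence

variable {δ δ' : ℝ} {w : EuclideanSpace ℝ (Fin 3) → EuclideanSpace ℝ (Fin 3)} {A : ℝ≥0∞}
  {q : EuclideanSpace ℝ (Fin 3) → ℝ}

/-- **The slice pressure-gradient functional does not depend on the regularisation scale.** For a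
measurable uniformly locally `L²` field `w`, `q ∈ L¹_loc`, and the slice pressure Poisson equation, for all
`δ, δ' > 0`, centres `c` and directions `e`:
`∫ [q ∂ₑλ_δ(c − ·) + D³Φ_δ(c − ·)(e)(w,w)] = ∫ [q ∂ₑλ_{δ'}(c − ·) + D³Φ_{δ'}(c − ·)(e)(w,w)]`.
(The Poisson equation tested with `θ = ∂ₑ(Φ_δ − Φ_{δ'})(c − ·) ∈ C_c^∞`.) [folklore] -/
theorem sliceFunctional_eq_of_poisson (hδ : 0 < δ) (hδ' : 0 < δ')
    (hw : AEStronglyMeasurable w volume) (hAtop : A ≠ ⊤)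
    (hA : ∀ z : EuclideanSpace ℝ (Fin 3), ∫⁻ y in ball z 1, ‖w y‖ₑ ^ 2 ≤ A)
    (hq : LocallyIntegrable q volume)
    (hP : ∀ θ : EuclideanSpace ℝ (Fin 3) → ℝ,
      FunctionSpaces.IsTestFunctionOn (⊤ : TopologicalSpace.Opens (EuclideanSpace ℝ (Fin 3))) θ →
        ∫ x, q x * Δ θ x = -∫ x, fderiv ℝ (fderiv ℝ θ) x (w x) (w x))
    (c e : EuclideanSpace ℝ (Fin 3)) :
    ∫ x, (q x * fderiv ℝ (Δ (newtonReg δ)) (c - x) e +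
        evalDiag (w x) (fderiv ℝ (fderiv ℝ (fderiv ℝ (newtonReg δ))) (c - x) e)) =
      ∫ x, (q x * fderiv ℝ (Δ (newtonReg δ')) (c - x) e +
        evalDiag (w x) (fderiv ℝ (fderiv ℝ (fderiv ℝ (newtonReg δ'))) (c - x) e)) := by
  set χ : EuclideanSpace ℝ (Fin 3) → ℝ := fun z => newtonReg δ z - newtonReg δ' z with hχ
  have hχ3 : ContDiff ℝ 3 χ := (contDiff_and_hasCompactSupport_newtonReg_sub hδ hδ' (n := 3)).1
  set θ : EuclideanSpace ℝ (Fin 3) → ℝ := fun y => fderiv ℝ χ (c - y) e with hθ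
  have hθtest := isTestFunctionOn_fderiv_newtonReg_sub hδ hδ' c e
  have hid := hP θ hθtest
  -- rewrite the two sides of the Poisson identity
  have hΔθ : ∀ x, Δ θ x = fderiv ℝ (Δ (newtonReg δ)) (c - x) e - fderiv ℝ (Δ (newtonReg δ')) (c - x) e := by
    intro x
    rw [hθ, laplacian_fderiv_comp_const_sub hχ3, hχ, fderiv_laplacian_newtonReg_sub hδ hδ']
  have hD2θ : ∀ x, fderiv ℝ (fderiv ℝ θ) x (w x) (w x) =
      evalDiag (w x) (fderiv ℝ (fderiv ℝ (fderiv ℝ (newtonReg δ))) (c - x) e) -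
        evalDiag (w x) (fderiv ℝ (fderiv ℝ (fderiv ℝ (newtonReg δ'))) (c - x) e) := by
    intro x
    rw [hθ, fderiv2_fderiv_comp_const_sub_apply hχ3, hχ, fderiv3_newtonReg_sub, evalDiag_apply,
      evalDiag_apply, _root_.sub_apply, _root_.sub_apply,
      _root_.sub_apply]
  simp_rw [hΔθ, hD2θ, mul_sub] at hid
  -- integrability of the four pieces
  have hp1 := integrable_pressureTerm hδ hq c e
  have hp2 := integrable_pressureTerm hδ' hq c e
  have hv1 := integrable_evalDiag_fderiv3_newtonReg hδ hw hAtop hA c e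
  have hv2 := integrable_evalDiag_fderiv3_newtonReg hδ' hw hAtop hA c e
  rw [integral_sub hp1 hp2, integral_sub hv1 hv2] at hid
  rw [integral_add hp1 hv1, integral_add hp2 hv2]
  linarith

end Independence

/-! ## The integration by parts for the pressure part -/

/-- **`∫ q(x) ∂ₑλ(c − x) dx = ∫ ∂ₑq(x) λ(c − x) dx`** for `q ∈ C¹` and a `C¹` compactly supported profile
`λ` (one integration by parts; no boundary terms). [folklore] -/
theorem pressureTerm_eq_integral_fderiv_mul {q lam : EuclideanSpace ℝ (Fin 3) → ℝ} (hq : ContDiff ℝ 1 q)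
    (hl : ContDiff ℝ 1 lam) (hls : HasCompactSupport lam) (c e : EuclideanSpace ℝ (Fin 3)) :
    ∫ x, q x * fderiv ℝ lam (c - x) e = ∫ x, fderiv ℝ q x e * lam (c - x) := by
  set g : EuclideanSpace ℝ (Fin 3) → ℝ := fun x => lam (c - x) with hg
  have hg1 : ContDiff ℝ 1 g := hl.comp (contDiff_const.sub contDiff_id)
  have hgs : HasCompactSupport g := hls.comp_homeomorph (Homeomorph.subLeft c)
  have hgd : ∀ x, fderiv ℝ g x e = -(fderiv ℝ lam (c - x) e) := by
    intro x; rw [hg, fderiv_comp_const_sub lam c x, _root_.neg_apply]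
  have hqc : Continuous q := hq.continuous
  have hqD : Continuous fun x => fderiv ℝ q x e := (hq.continuous_fderiv one_ne_zero).clm_apply continuous_const
  have hgD : Continuous fun x => fderiv ℝ g x e := (hg1.continuous_fderiv one_ne_zero).clm_apply continuous_const
  have i1 : Integrable (fun x => fderiv ℝ q x e * g x) :=
    (hqD.mul hg1.continuous).integrable_of_hasCompactSupport hgs.mul_left
  have i2 : Integrable (fun x => q x * fderiv ℝ g x e) :=
    (hqc.mul hgD).integrable_of_hasCompactSupport (hgs.fderiv_apply (𝕜 := ℝ) e).mul_left
  have i3 : Integrable (fun x => q x * g x) :=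
    (hqc.mul hg1.continuous).integrable_of_hasCompactSupport hgs.mul_left
  have hibp := integral_mul_fderiv_eq_neg_fderiv_mul_of_integrable (μ := volume) i1 i2 i3
    (fun x _ => hq.differentiable one_ne_zero x) (fun x _ => hg1.differentiable one_ne_zero x)
  have h1 : (fun x => q x * fderiv ℝ lam (c - x) e) = fun x => -(q x * fderiv ℝ g x e) := by
    funext x; rw [hgd]; ring
  rw [h1, integral_neg, hibp, neg_neg]

/-! ## The wide test bump `θ_R = λ_R(c − ·)` -/

section Bump

variable {R : ℝ}

/-- `θ_R = λ_R(c − ·)` is a test function. [folklore] -/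
theorem isTestFunctionOn_laplacian_newtonReg_comp_sub (hR : 0 < R) (c : EuclideanSpace ℝ (Fin 3)) :
    FunctionSpaces.IsTestFunctionOn (⊤ : TopologicalSpace.Opens (EuclideanSpace ℝ (Fin 3)))
      (fun x => Δ (newtonReg R) (c - x)) := by
  refine ⟨(contDiff_laplacian_newtonReg hR).comp (contDiff_const.sub contDiff_id), ?_, by simp⟩
  refine HasCompactSupport.intro (isCompact_closedBall c R) fun x hx => ?_
  rw [mem_closedBall, dist_eq_norm, not_le, ← norm_sub_rev] at hx
  exact laplacian_newtonReg_eq_zero hR hx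

/-- `∫ |θ_R| = ∫ |λ₁|`. [folklore] -/
theorem integral_abs_bump (hR : 0 < R) (c : EuclideanSpace ℝ (Fin 3)) :
    ∫ x, |Δ (newtonReg R) (c - x)| = ∫ w : EuclideanSpace ℝ (Fin 3), |newtonFarLaplacian (1 / 2) 1 w| := by
  rw [integral_sub_left_eq_self (fun z => |Δ (newtonReg R) z|) volume c, integral_abs_laplacian_newtonReg hR]

/-- `∫ ‖Dθ_R‖ = R⁻¹ ∫ ‖Dλ₁‖`. [folklore] -/
theorem integral_norm_fderiv_bump (hR : 0 < R) (c : EuclideanSpace ℝ (Fin 3)) :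
    ∫ x, ‖fderiv ℝ (fun y => Δ (newtonReg R) (c - y)) x‖ =
      R⁻¹ * ∫ z : EuclideanSpace ℝ (Fin 3), ‖fderiv ℝ (newtonFarLaplacian (1 / 2) 1) z‖ := by
  have h1 : ∀ x, ‖fderiv ℝ (fun y => Δ (newtonReg R) (c - y)) x‖ = ‖fderiv ℝ (Δ (newtonReg R)) (c - x)‖ := by
    intro x; rw [fderiv_comp_const_sub, norm_neg]
  simp_rw [h1]
  rw [integral_sub_left_eq_self (fun z => ‖fderiv ℝ (Δ (newtonReg R)) z‖) volume c,
    integral_norm_fderiv_laplacian_newtonReg hR]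

/-- `∫ ‖D²θ_R‖ = R⁻² ∫ ‖D²λ₁‖`. [folklore] -/
theorem integral_norm_fderiv2_bump (hR : 0 < R) (c : EuclideanSpace ℝ (Fin 3)) :
    ∫ x, ‖fderiv ℝ (fderiv ℝ (fun y => Δ (newtonReg R) (c - y))) x‖ =
      R⁻¹ ^ 2 * ∫ z : EuclideanSpace ℝ (Fin 3), ‖fderiv ℝ (fderiv ℝ (newtonFarLaplacian (1 / 2) 1)) z‖ := by
  have h1 : ∀ x, ‖fderiv ℝ (fderiv ℝ (fun y => Δ (newtonReg R) (c - y))) x‖ =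
      ‖fderiv ℝ (fderiv ℝ (Δ (newtonReg R))) (c - x)‖ := by
    intro x; rw [fderiv2_comp_const_sub]
  simp_rw [h1]
  rw [integral_sub_left_eq_self (fun z => ‖fderiv ℝ (fderiv ℝ (Δ (newtonReg R))) z‖) volume c,
    integral_norm_fderiv2_laplacian_newtonReg hR]

/-- `∫ ‖Δθ_R‖ = R⁻² ∫ ‖Δλ₁‖`. [folklore] -/
theorem integral_norm_laplacian_bump (hR : 0 < R) (c : EuclideanSpace ℝ (Fin 3)) :
    ∫ x, ‖Δ (fun y => Δ (newtonReg R) (c - y)) x‖ =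
      R⁻¹ ^ 2 * ∫ z : EuclideanSpace ℝ (Fin 3), ‖Δ (newtonFarLaplacian (1 / 2) 1) z‖ := by
  have h1 : ∀ x, ‖Δ (fun y => Δ (newtonReg R) (c - y)) x‖ = ‖Δ (Δ (newtonReg R)) (c - x)‖ := by
    intro x; rw [laplacian_comp_const_sub]
  simp_rw [h1]
  rw [integral_sub_left_eq_self (fun z => ‖Δ (Δ (newtonReg R)) z‖) volume c,
    integral_norm_laplacian_laplacian_newtonReg hR]

end Bump

end Summit.NavierStokesRegularity.NavierStokesRegularity.Theorems.PoloidalWindowDoorPoloidalWindowRigiditySliceFunctionalScale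

end
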